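import Summits.BirchSwinnertonDyer.Rank1Residual.Iwasawa.UnitCoefficientCertificate
import HarnessLib

/-!
# The unit-coefficient certificate at a multiplicative prime, §3: Kato + certificate — the squeeze,
# MINIMAL pairs, `ord_{T=0} f_E = rank`, Schneider ∧ `Ш[p^∞]` finite (cell `b2b-bsdres`, instrument
# unit `b2b-bsdres-iw-1` — IWASAWA-INVARIANT CENSUS Part I, gen 2; kernel companion of
# HOME/IWASAWA-CENSUS.md §4.4 (1) and §4.6; second half of `Iwasawa/UnitCoefficientCertificate.lean`)

HONEST FRAMING (run/shared/lean/b2b/bsd-rank1-residual/, verbatim in every file): prove what is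
provable now; shrink each hard class to its core with data; no claim beyond stated classes. The goal
of the cell is to DELETE the COMBINATION-SHAPED residual classes of the Birch–Swinnerton-Dyer formula
for ALL analytic-rank `≤ 1` elliptic curves over `ℚ`, assembled STRICTLY from published theorems, so
that the rank-`≤ 1` remainder becomes exactly the CONSTRUCTION-SHAPED classes, which are TYPED
(missing-input `Prop`s), NOT attempted. This is not "finishing BSD". NO CLAIM BEYOND STATED CLASSES.
Theorems only, plus TWO `Prop`-valued certificate / typed-input shapes (`UnitCoeffAt`, `LamAlgGEAt`;
nothing asserted); no named fact is introduced.

## What this file proves (the MINING compositions of the census, made kernel-hard)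

The census (HOME/IWASAWA-CENSUS.md, 1663 residual pairs `(E, p)` at good-ordinary / multiplicative
`p` with `E[p]` irreducible) certifies per pair, with two independent engines, `μ_an(E,p) = 0` and
the `λ`-invariant `λ_an` of the Néron-normalised Mazur–Tate–Teitelbaum function `ϖ·L_p` — concretely:
the coefficient of index `λ_an` of `ϖ·L_p` is a `p`-ADIC UNIT and all earlier ones are non-units.
Its two "mining" compositions (§4.4 (1) "minimal pairs", §4.6 "squeeze") are proved here over the
tree's vocabulary (`X1.MuLambda.mu/lam`, `X11a.InvariantsAt`, `X2.MazurMainConjectureAt`):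

* §1 (pure `Λ`-algebra: the squeeze `span_eq_span_of_dvd_of_lam_le`, `minimal_package`) and §2 (the
  shapes `UnitCoeffAt W p n`, `LamAlgGEAt W p n`, `invariantsAt_of_unitCoeffAt`) are the companion module
  `Iwasawa/UnitCoefficientCertificate.lean` (imported);
* §3 at a multiplicative prime `p ≠ 2` with `ρ_{E,p^∞}` surjective (every `ρ̄_{E,p^n}` onto: `p ≥ 5`
  from `ρ̄_{E,p}` onto by Serre, `p = 3` by Wuthrich's Lemma 20 since `9 ∤ N`), Kato's divisibility
  (`Wuthrich2014.kato_charIdeal_dvd_multiplicative_of_surjective`, hypothesis `hKato`) and: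
  - SQUEEZE: `UnitCoeffAt W p n ∧ LamAlgGEAt W p n ⇒` Mazur's main conjecture at `(E,p)`
    (`mazurMainConjectureAt_of_unitCoeffAt_of_lamAlgGEAt`; census §4.6: 1344 Kato-integral pairs with
    `λ_an = LB`, conditional on the typed bound at `n = LB − e > r`);
  - MINIMAL PAIRS: `UnitCoeffAt W p (rank E(ℚ)) ⇒` Mazur's main conjecture at `(E,p)` AND, for every
    dual datum and generator, `ord_{T=0} f_E = rank E(ℚ)` with unit leading coefficient
    (`invariantsAt_of_unitCoeffAt_mordellWeilRank`, `mazurMainConjectureAt_of_unitCoeffAt_mordellWeilRank`;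
    census §4.4 (1): 1081 pairs, 435 of analytic rank `1`), hence by Stein–Wuthrich Thm. 6.1 clause 2
    (named facts `thm61_splitMultiplicative` / `thm61_nonsplitMultiplicative`, hypotheses) Schneider's
    conjecture for THE canonical height and finiteness of `Ш(E/ℚ)[p^∞]` at the pair
    (`schneider_and_finite_sha_of_unitCoeffAt_split` / `_nonsplit`) — NO `p`-adic regulator is
    computed (contrast the lane's `Typed.PAdicCertificateEngine`, whose `hcert` is a regulator
    valuation); analytic-rank versions via Gross–Zagier–Kolyvagin (`hGZK`).
  This is the Stein–Wuthrich "unit quotient" remark (Math. Comp. 82 (2013) p. 29: same order of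
  vanishing and same leading valuation ⇒ the Kato quotient is a unit in `ℤ_p⟦T⟧`) in the `(μ, λ)` form of
  Greenberg–Vatsal p. 4; the census's contribution is the certified unit coefficient, pair by pair.

References: [GreenbergVatsal2000] (1)–(2), p. 4; [SteinWuthrich2013] Thm. 6.1 (p. 20), §11 remark
(p. 29); [Wuthrich2014] Thm. 3, Cor. 19 (p. 399), Lemma 20 (p. 399); [Washington1997] §7.1;
[GreenbergLNM1716] §3 Lemma 3.1, Cor. 5.6; HOME/IWASAWA-CENSUS.md §4.4, §4.6 (rev. 2).

FILE SPLIT (gate rule: cell-topic files ≤ 400 lines; filed by the prover seat multr1-p2 gen 4 at the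
iw-1 seat's request, `b2b-bsdres-iw-1/lean/HANDOVER.md`, content UNCHANGED): §1 (pure `Λ`-algebra) and
§2 (the shapes `UnitCoeffAt`, `LamAlgGEAt`) are `Iwasawa/UnitCoefficientCertificate.lean`; this module
is §3.
-/

noncomputable section

open scoped Classical MatrixGroups ModularForm

open CongruenceSubgroup WeierstrassCurve Literature.NumberTheory.EllipticCurves
  Literature.NumberTheory.EllipticCurves.ModularForms
  Literature.NumberTheory.EllipticCurves.Rank1Residual
  Literature.NumberTheory.EllipticCurves.Rank1Residual.Typed
  Literature.NumberTheory.EllipticCurves.Wuthrich2014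
  Literature.NumberTheory.EllipticCurves.GreenbergVatsal2000
  Literature.NumberTheory.EllipticCurves.SteinWuthrich2013
  Summit.BirchSwinnertonDyer.Rank1Residual.X1.MuLambda
  Summit.BirchSwinnertonDyer.Rank1Residual.X11a
  Summit.BirchSwinnertonDyer.Rank1Residual.X11a.LambdaNorm

set_option autoImplicit false

namespace Summit.BirchSwinnertonDyer.Rank1Residual.Iwasawa

/-! ## §3. At a multiplicative prime with `ρ_{E,p^∞}` surjective: Kato + certificate -/

section Multiplicative

variable (W : WeierstrassCurve ℚ) [W.IsElliptic] [W.IsGloballyMinimal] (p : ℕ) [Fact p.Prime]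

/-- **Kato's divisibility at the pairs, `p`-adic-surjectivity form**: at a multiplicative `p ≠ 2`
with every `ρ̄_{E,p^n}` surjective, `X(E/ℚ_∞)`-generators divide Kato elements: `fE ∣ g` at every
Kato pair (x11a's `invariantsAt_dvd_of_kato` with the image hypothesis explicit, so that `p = 3` is
covered via Wuthrich's Lemma 20). [cite: Wuthrich2014, Thm. 3 (p. 382) and Cor. 19 proof (p. 399)] -/
theorem invariantsAt_dvd_of_kato_of_surjective_pow
    (hKato : kato_charIdeal_dvd_multiplicative_of_surjective)
    (hp2 : p ≠ 2) (hmult : W.HasMultiplicativeReductionAtPrime p)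
    (hsurj' : ∀ n : ℕ, W.HasSurjectiveModNGaloisRep (p ^ n : ℕ)) :
    InvariantsAt W p fun g fE => fE ∣ g := by
  intro κ γ hκ hγ hγ' N _ f hf D ϖ hϖ fE g hchar
  obtain ⟨-, hKns, hKs⟩ := hKato W p hp2 hmult hsurj' hκ hγ hγ' hf D ϖ hϖ
  have hinj := iwasawaToPowerSeries_injective p
  refine ⟨fun hns L hL hι => ?_, fun hs L hL hι => ?_⟩
  · obtain ⟨g', hg'mem, hι'⟩ := hKns hns L hL
    have hgg' : g = g' := hinj (hι.trans hι'.symm)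
    rw [hgg']
    rw [hchar] at hg'mem
    exact Ideal.mem_span_singleton.mp hg'mem
  · obtain ⟨g', hg'mem, hι'⟩ := hKs hs L hL
    have hXg : (PowerSeries.X : IwasawaAlgebra p) * g = PowerSeries.X * g' :=
      hinj (hι.trans hι'.symm)
    have hgg' : g = g' := mul_left_cancel₀ PowerSeries.X_ne_zero hXg
    rw [hgg']
    rw [hchar] at hg'mem
    exact Ideal.mem_span_singleton.mp hg'mem

/-- **From `(gK) = (fE)` at every Kato pair to Mazur's main conjecture at `(E, p)`** (the shape
`X2.MazurMainConjectureAt`: torsion, a generator `g` of `char_Λ X`, and a unit `w` with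
`ι(T^e · g · w) = ϖ·L_p`): torsion is Kato's, the generator is `fE` (`Λ` a PID-like UFD: principal
characteristic ideal), and `gK = fE · w` with `w ∈ Λˣ` from `(gK) = (fE)` in the domain `Λ`. No
non-vanishing input is needed. [cite: Wuthrich2014, Thm. 3 (p. 382) and Cor. 19 proof (p. 399)]
[cite: GreenbergVatsal2000, p. 4 (after Thm. (1.2))] -/
theorem mazurMainConjectureAt_of_invariantsAt_span_eq
    (hKato : kato_charIdeal_dvd_multiplicative_of_surjective)
    (hp2 : p ≠ 2) (hmult : W.HasMultiplicativeReductionAtPrime p)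
    (hsurj' : ∀ n : ℕ, W.HasSurjectiveModNGaloisRep (p ^ n : ℕ))
    (h : InvariantsAt W p fun g fE => Ideal.span ({g} : Set (IwasawaAlgebra p)) = Ideal.span {fE}) :
    X2.MazurMainConjectureAt W p := by
  intro κ γ hκ hγ hγ' N _ f hf D ϖ hϖ
  haveI : Module.Finite (IwasawaAlgebra p) D.X := D.module_finite_holds hγ
  obtain ⟨hX, hKns, hKs⟩ := hKato W p hp2 hmult hsurj' hκ hγ hγ' hf D ϖ hϖ
  haveI : (Literature.NumberTheory.EllipticCurves.Module.charIdeal (IwasawaAlgebra p) D.X).IsPrincipal :=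
    charIdeal_isPrincipal_holds p D.X
  obtain ⟨fE, hfE⟩ := Submodule.IsPrincipal.principal
    (Literature.NumberTheory.EllipticCurves.Module.charIdeal (IwasawaAlgebra p) D.X)
  have hchar : D.charIdeal = Ideal.span {fE} := hfE
  refine ⟨hX, fE, hchar, fun hsplit L hL => ?_, fun hns L hL => ?_⟩
  · obtain ⟨g, -, hιg⟩ := hKs hsplit L hL
    have hspan := (h κ γ hκ hγ hγ' f hf D ϖ hϖ fE g hchar).2 hsplit L hL hιg
    obtain ⟨u, hu⟩ := Ideal.span_singleton_eq_span_singleton.mp hspan.symm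
    refine ⟨u, ?_⟩
    rw [mul_assoc, hu]
    exact hιg
  · obtain ⟨g, -, hιg⟩ := hKns hns L hL
    have hspan := (h κ γ hκ hγ hγ' f hf D ϖ hϖ fE g hchar).1 hns L hL hιg
    obtain ⟨u, hu⟩ := Ideal.span_singleton_eq_span_singleton.mp hspan.symm
    refine ⟨u, ?_⟩
    rw [hu]
    exact hιg

/-! ### The squeeze (census §4.6) -/

/-- **SQUEEZE at the pair**: Kato integral (`p ≠ 2`, multiplicative, `ρ_{E,p^∞}` onto), the
unit-coefficient certificate `UnitCoeffAt W p n` and the typed bound `LamAlgGEAt W p n` give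
`(gK) = (fE)`, `μ(gK) = μ(fE) = 0` and `λ(gK) = λ(fE)` at every Kato pair.
[cite: GreenbergVatsal2000, p. 4 (after Thm. (1.2))] [cite: SteinWuthrich2013, §11 remark (p. 29)] -/
theorem invariantsAt_span_eq_of_unitCoeffAt_of_lamAlgGEAt
    (hKato : kato_charIdeal_dvd_multiplicative_of_surjective)
    (hp2 : p ≠ 2) (hmult : W.HasMultiplicativeReductionAtPrime p)
    (hsurj' : ∀ n : ℕ, W.HasSurjectiveModNGaloisRep (p ^ n : ℕ))
    {n : ℕ} (hcert : UnitCoeffAt W p n) (hLB : LamAlgGEAt W p n) :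
    InvariantsAt W p fun g fE =>
      Ideal.span ({g} : Set (IwasawaAlgebra p)) = Ideal.span {fE} ∧
        HasUnitContent g ∧ HasUnitContent fE ∧ mu g = mu fE ∧ lam g = lam fE := by
  refine (((invariantsAt_of_unitCoeffAt hcert).and hLB).and
    (invariantsAt_dvd_of_kato_of_surjective_pow W p hKato hp2 hmult hsurj')).mono fun g fE h' => ?_
  obtain ⟨⟨⟨hg, hle⟩, hlb⟩, hdvd⟩ := h'
  have hle' : lam g ≤ lam fE := hle.trans hlb
  have hspan := span_eq_span_of_dvd_of_lam_le hg hdvd hle'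
  obtain ⟨c, hc⟩ := hdvd
  have hfE : HasUnitContent fE := hasUnitContent_left_of_mul (a := fE) (b := c) (hc ▸ hg)
  have hg0 : g ≠ 0 := ne_zero_of_hasUnitContent hg
  have hfE0 : fE ≠ 0 := ne_zero_of_hasUnitContent hfE
  obtain ⟨hmu, hlam⟩ := (span_eq_span_iff_mu_lam hfE0 hg0 hc).mp hspan
  exact ⟨hspan, hg, hfE, hmu, hlam⟩

/-- **SQUEEZE ⇒ Mazur's main conjecture at `(E, p)`** (census §4.6, kernel form: the typed input
is `LamAlgGEAt W p n`, the certificate is `UnitCoeffAt W p n`; at `n = rank E(ℚ)` the typed input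
is discharged below). [cite: GreenbergVatsal2000, p. 4 (after Thm. (1.2))] [cite: SteinWuthrich2013, §11 remark (p. 29)] -/
theorem mazurMainConjectureAt_of_unitCoeffAt_of_lamAlgGEAt
    (hKato : kato_charIdeal_dvd_multiplicative_of_surjective)
    (hp2 : p ≠ 2) (hmult : W.HasMultiplicativeReductionAtPrime p)
    (hsurj' : ∀ n : ℕ, W.HasSurjectiveModNGaloisRep (p ^ n : ℕ))
    {n : ℕ} (hcert : UnitCoeffAt W p n) (hLB : LamAlgGEAt W p n) :
    X2.MazurMainConjectureAt W p :=
  mazurMainConjectureAt_of_invariantsAt_span_eq W p hKato hp2 hmult hsurj'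
    ((invariantsAt_span_eq_of_unitCoeffAt_of_lamAlgGEAt W p hKato hp2 hmult hsurj' hcert hLB).mono
      fun _ _ h' => h'.1)

/-- The squeeze also gives x11a's `InvariantsMatchAt` (EPW's "`μ^alg = μ^an`, `λ^alg = λ^an`" at
`f_E`). [cite: EmertonPollackWeston2006, Thm. 5.1.3 (shape)] [cite: GreenbergVatsal2000, p. 4 (after Thm. (1.2))] -/
theorem invariantsMatchAt_of_unitCoeffAt_of_lamAlgGEAt
    (hKato : kato_charIdeal_dvd_multiplicative_of_surjective)
    (hp2 : p ≠ 2) (hmult : W.HasMultiplicativeReductionAtPrime p)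
    (hsurj' : ∀ n : ℕ, W.HasSurjectiveModNGaloisRep (p ^ n : ℕ))
    {n : ℕ} (hcert : UnitCoeffAt W p n) (hLB : LamAlgGEAt W p n) : InvariantsMatchAt W p :=
  (invariantsMatchAt_iff W p).mpr
    ((invariantsAt_span_eq_of_unitCoeffAt_of_lamAlgGEAt W p hKato hp2 hmult hsurj' hcert hLB).mono
      fun _ _ h' => ⟨h'.2.2.2.1, h'.2.2.2.2⟩)

/-! ### Minimal pairs (census §4.4 (1)): `n = rank E(ℚ)` -/

/-- **The typed bound at `n = rank E(ℚ)` is a THEOREM at Kato-integral pairs carrying `μ_an = 0`**: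
`rank E(ℚ) ≤ λ(fE)` — from `T^{rank} ∣ fE` (`rank E(ℚ) ≤ rank_{ℤ_p} X_Γ ≤ ord_{T=0} fE`, tree
theorem `Typed.X_pow_mordellWeilRank_dvd_of_charIdeal_eq_span`, torsion by Kato) and unit content
of `fE` (certificate + Kato). [cite: GreenbergLNM1716, §3 Lemma 3.1 and §1 p. 65] -/
theorem lamAlgGEAt_mordellWeilRank
    (hKato : kato_charIdeal_dvd_multiplicative_of_surjective)
    (hp2 : p ≠ 2) (hmult : W.HasMultiplicativeReductionAtPrime p)
    (hsurj' : ∀ n : ℕ, W.HasSurjectiveModNGaloisRep (p ^ n : ℕ)) (hμ : MuAnZeroAt W p) :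
    LamAlgGEAt W p W.mordellWeilRank := by
  have hA := (invariantsAt_hasUnitContent_of_muAnZeroAt W p hμ).and
    (invariantsAt_dvd_of_kato_of_surjective_pow W p hKato hp2 hmult hsurj')
  intro κ γ hκ hγ hγ' N _ f hf D ϖ hϖ fE g hchar
  haveI : Module.Finite (IwasawaAlgebra p) D.X := D.module_finite_holds hγ
  obtain ⟨hX, -, -⟩ := hKato W p hp2 hmult hsurj' hκ hγ hγ' hf D ϖ hϖ
  have hTr : (PowerSeries.X : IwasawaAlgebra p) ^ W.mordellWeilRank ∣ fE :=
    X_pow_mordellWeilRank_dvd_of_charIdeal_eq_span W p hγ D hX hchar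
  have key : HasUnitContent g ∧ fE ∣ g → W.mordellWeilRank ≤ lam fE := fun h' => by
    obtain ⟨hg, c, hc⟩ := h'
    exact le_lam_of_X_pow_dvd (hasUnitContent_left_of_mul (a := fE) (b := c) (hc ▸ hg)) hTr
  have hA' := hA κ γ hκ hγ hγ' f hf D ϖ hϖ fE g hchar
  exact ⟨fun hns L hL hι => key (hA'.1 hns L hL hι), fun hs L hL hι => key (hA'.2 hs L hL hι)⟩

/-- **MINIMAL PAIRS — the full package at every Kato pair.** At a multiplicative `p ≠ 2` with
`ρ_{E,p^∞}` onto, Kato's divisibility and the certificate `UnitCoeffAt W p (rank E(ℚ))` (the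
coefficient of index `rank + e` of `ϖ·L_p` is a unit) give, for every dual datum `D`, every
generator `fE` of `char_Λ X(E/ℚ_∞)` and every Kato element `gK`: `(gK) = (fE)` (the main conjecture
at the pair), `λ(fE) = λ(gK) = rank E(ℚ)`, `μ(fE) = μ(gK) = 0`, **`ord_{T=0} fE = rank E(ℚ)`** and
`[T^{rank}] fE ∈ ℤ_pˣ`. No regulator, no leading-term formula is used.
[cite: SteinWuthrich2013, §11 remark (p. 29)] [cite: GreenbergVatsal2000, p. 4 (after Thm. (1.2))]
[cite: GreenbergLNM1716, §3 Lemma 3.1] -/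
theorem invariantsAt_of_unitCoeffAt_mordellWeilRank
    (hKato : kato_charIdeal_dvd_multiplicative_of_surjective)
    (hp2 : p ≠ 2) (hmult : W.HasMultiplicativeReductionAtPrime p)
    (hsurj' : ∀ n : ℕ, W.HasSurjectiveModNGaloisRep (p ^ n : ℕ))
    (hcert : UnitCoeffAt W p W.mordellWeilRank) :
    InvariantsAt W p fun g fE =>
      Ideal.span ({g} : Set (IwasawaAlgebra p)) = Ideal.span {fE} ∧
        lam fE = W.mordellWeilRank ∧ lam g = W.mordellWeilRank ∧ mu fE = 0 ∧ mu g = 0 ∧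
        fE.order = W.mordellWeilRank ∧ IsUnit (PowerSeries.coeff W.mordellWeilRank fE) := by
  have hA := (invariantsAt_of_unitCoeffAt hcert).and
    (invariantsAt_dvd_of_kato_of_surjective_pow W p hKato hp2 hmult hsurj')
  intro κ γ hκ hγ hγ' N _ f hf D ϖ hϖ fE g hchar
  haveI : Module.Finite (IwasawaAlgebra p) D.X := D.module_finite_holds hγ
  obtain ⟨hX, -, -⟩ := hKato W p hp2 hmult hsurj' hκ hγ hγ' hf D ϖ hϖ
  have hTr : (PowerSeries.X : IwasawaAlgebra p) ^ W.mordellWeilRank ∣ fE :=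
    X_pow_mordellWeilRank_dvd_of_charIdeal_eq_span W p hγ D hX hchar
  have key : (HasUnitContent g ∧ lam g ≤ W.mordellWeilRank) ∧ fE ∣ g →
      Ideal.span ({g} : Set (IwasawaAlgebra p)) = Ideal.span {fE} ∧
        lam fE = W.mordellWeilRank ∧ lam g = W.mordellWeilRank ∧ mu fE = 0 ∧ mu g = 0 ∧
        fE.order = W.mordellWeilRank ∧ IsUnit (PowerSeries.coeff W.mordellWeilRank fE) :=
    fun h' => minimal_package h'.1.1 h'.2 hTr h'.1.2
  have hA' := hA κ γ hκ hγ hγ' f hf D ϖ hϖ fE g hchar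
  exact ⟨fun hns L hL hι => key (hA'.1 hns L hL hι), fun hs L hL hι => key (hA'.2 hs L hL hι)⟩

/-- **MINIMAL PAIRS ⇒ Mazur's main conjecture at `(E, p)`** (census §4.4 (1): 1081 pairs of the
residual list, rev. 2). [cite: SteinWuthrich2013, §11 remark (p. 29)] [cite: GreenbergVatsal2000, p. 4 (after Thm. (1.2))] -/
theorem mazurMainConjectureAt_of_unitCoeffAt_mordellWeilRank
    (hKato : kato_charIdeal_dvd_multiplicative_of_surjective)
    (hp2 : p ≠ 2) (hmult : W.HasMultiplicativeReductionAtPrime p)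
    (hsurj' : ∀ n : ℕ, W.HasSurjectiveModNGaloisRep (p ^ n : ℕ))
    (hcert : UnitCoeffAt W p W.mordellWeilRank) : X2.MazurMainConjectureAt W p :=
  mazurMainConjectureAt_of_invariantsAt_span_eq W p hKato hp2 hmult hsurj'
    ((invariantsAt_of_unitCoeffAt_mordellWeilRank W p hKato hp2 hmult hsurj' hcert).mono
      fun _ _ h' => h'.1)

/-- Minimal pairs also give x11a's `InvariantsMatchAt W p`. [cite: GreenbergVatsal2000, p. 4 (after Thm. (1.2))] -/
theorem invariantsMatchAt_of_unitCoeffAt_mordellWeilRank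
    (hKato : kato_charIdeal_dvd_multiplicative_of_surjective)
    (hp2 : p ≠ 2) (hmult : W.HasMultiplicativeReductionAtPrime p)
    (hsurj' : ∀ n : ℕ, W.HasSurjectiveModNGaloisRep (p ^ n : ℕ))
    (hcert : UnitCoeffAt W p W.mordellWeilRank) : InvariantsMatchAt W p :=
  (invariantsMatchAt_iff W p).mpr
    ((invariantsAt_of_unitCoeffAt_mordellWeilRank W p hKato hp2 hmult hsurj' hcert).mono
      fun _ _ h' => ⟨by rw [h'.2.2.2.1, h'.2.2.2.2.1], by rw [h'.2.1, h'.2.2.1]⟩)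

/-! ### Minimal pairs, `ord_{T=0} f_E = rank`: Schneider's conjecture and `Ш[p^∞]` finite -/

/-- **Split multiplicative `p`, minimal pair ⇒ Schneider's conjecture for THE canonical height and
`Ш(E/ℚ)[p^∞]` finite.** Kato (`hKato`, `p ≠ 2`, `ρ_{E,p^∞}` onto) + the certificate
`UnitCoeffAt W p (rank E(ℚ))` give `ord_{T=0} f_E = rank E(ℚ)` for every generator
(`invariantsAt_of_unitCoeffAt_mordellWeilRank`); Stein–Wuthrich Thm. 6.1 clause 2 (named fact
`thm61_splitMultiplicative`, hypothesis `hJs`; Schneider, Perrin-Riou, Jones) converts it. The data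
`f, ϖ, L` (a newform, its period ratio, THE split MTT function) only serve to instantiate the
certificate. [cite: SteinWuthrich2013, Thm. 6.1 (p. 20)] [cite: Wuthrich2014, Cor. 19 proof (p. 399)] -/
theorem schneider_and_finite_sha_of_unitCoeffAt_split
    (hKato : kato_charIdeal_dvd_multiplicative_of_surjective) (hJs : thm61_splitMultiplicative)
    (hp2 : p ≠ 2) (hmult : W.HasMultiplicativeReductionAtPrime p)
    (hsurj' : ∀ n : ℕ, W.HasSurjectiveModNGaloisRep (p ^ n : ℕ))
    (hcert : UnitCoeffAt W p W.mordellWeilRank)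
    (hsplit : W.HasSplitMultiplicativeReductionAtPrime p) (Dq : TateParameterData W p)
    {κ : ZpExtension ℚ p} {γ : Field.absoluteGaloisGroup ℚ}
    (hκ : κ.IsCyclotomic) (hγ : κ.IsTopGenerator γ) (hγ' : IsCyclotomicVariable p γ)
    {N : ℕ} [NeZero N] (f : CuspForm (Gamma0 N) 2) (hf : IsNewformOf W f)
    (D : W.SelmerDualData κ γ) (ϖ : ℚ) (hϖ : (ϖ : ℝ) * W.realPeriodRat = plusPeriod f)
    (L : PowerSeries ℚ_[p]) (hL : IsSplitMultPAdicLFunctionOf f p L)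
    (Dh : PAdicHeightData W p) (hDh : IsSplitMultCanonical Dh Dq) :
    SchneiderConjecture Dh ∧ Finite (AddCommGroup.primaryComponent W.sha p) := by
  haveI : Module.Finite (IwasawaAlgebra p) D.X := D.module_finite_holds hγ
  obtain ⟨hX, -, hKs⟩ := hKato W p hp2 hmult hsurj' hκ hγ hγ' hf D ϖ hϖ
  haveI : (Literature.NumberTheory.EllipticCurves.Module.charIdeal (IwasawaAlgebra p) D.X).IsPrincipal :=
    charIdeal_isPrincipal_holds p D.X
  obtain ⟨fE, hfE⟩ := Submodule.IsPrincipal.principal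
    (Literature.NumberTheory.EllipticCurves.Module.charIdeal (IwasawaAlgebra p) D.X)
  have hchar : D.charIdeal = Ideal.span {fE} := hfE
  obtain ⟨g, -, hιg⟩ := hKs hsplit L hL
  have hord : fE.order = W.mordellWeilRank :=
    ((invariantsAt_of_unitCoeffAt_mordellWeilRank W p hKato hp2 hmult hsurj' hcert
      κ γ hκ hγ hγ' f hf D ϖ hϖ fE g hchar).2 hsplit L hL hιg).2.2.2.2.2.1
  exact (hJs W p hp2 Dq κ γ hκ hγ hγ' D hX fE hchar Dh hDh).2.1.mp hord

/-- **Non-split multiplicative `p`, minimal pair ⇒ Schneider's conjecture for THE canonical height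
and `Ш(E/ℚ)[p^∞]` finite** (as the split case, with `thm61_nonsplitMultiplicative`, `hJn`, and the
Tate parameter `q` given by its defining properties). [cite: SteinWuthrich2013, Thm. 6.1 (p. 20)]
[cite: Wuthrich2014, Cor. 19 proof (p. 399)] -/
theorem schneider_and_finite_sha_of_unitCoeffAt_nonsplit
    (hKato : kato_charIdeal_dvd_multiplicative_of_surjective) (hJn : thm61_nonsplitMultiplicative)
    (hp2 : p ≠ 2) (hmult : W.HasMultiplicativeReductionAtPrime p)
    (hns : ¬ W.HasSplitMultiplicativeReductionAtPrime p)
    (hsurj' : ∀ n : ℕ, W.HasSurjectiveModNGaloisRep (p ^ n : ℕ))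
    (hcert : UnitCoeffAt W p W.mordellWeilRank)
    (q : ℚ_[p]) (hq0 : q ≠ 0) (hq1 : ‖q‖ < 1) (hqj : tateJ q = (W.j : ℚ_[p]))
    {κ : ZpExtension ℚ p} {γ : Field.absoluteGaloisGroup ℚ}
    (hκ : κ.IsCyclotomic) (hγ : κ.IsTopGenerator γ) (hγ' : IsCyclotomicVariable p γ)
    {N : ℕ} [NeZero N] (f : CuspForm (Gamma0 N) 2) (hf : IsNewformOf W f)
    (D : W.SelmerDualData κ γ) (ϖ : ℚ) (hϖ : (ϖ : ℝ) * W.realPeriodRat = plusPeriod f)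
    (L : PowerSeries ℚ_[p]) (hL : IsMultPAdicLFunctionOf f p (-1) L)
    (Dh : PAdicHeightData W p) (hDh : IsMultCanonical Dh q) :
    SchneiderConjecture Dh ∧ Finite (AddCommGroup.primaryComponent W.sha p) := by
  haveI : Module.Finite (IwasawaAlgebra p) D.X := D.module_finite_holds hγ
  obtain ⟨hX, hKns, -⟩ := hKato W p hp2 hmult hsurj' hκ hγ hγ' hf D ϖ hϖ
  haveI : (Literature.NumberTheory.EllipticCurves.Module.charIdeal (IwasawaAlgebra p) D.X).IsPrincipal :=
    charIdeal_isPrincipal_holds p D.X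
  obtain ⟨fE, hfE⟩ := Submodule.IsPrincipal.principal
    (Literature.NumberTheory.EllipticCurves.Module.charIdeal (IwasawaAlgebra p) D.X)
  have hchar : D.charIdeal = Ideal.span {fE} := hfE
  obtain ⟨g, -, hιg⟩ := hKns hns L hL
  have hord : fE.order = W.mordellWeilRank :=
    ((invariantsAt_of_unitCoeffAt_mordellWeilRank W p hKato hp2 hmult hsurj' hcert
      κ γ hκ hγ hγ' f hf D ϖ hϖ fE g hchar).1 hns L hL hιg).2.2.2.2.2.1
  exact (hJn W p hp2 hmult hns q hq0 hq1 hqj κ γ hκ hγ hγ' D hX fE hchar Dh hDh).2.1.mp hord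

/-! ### The image hypothesis at `p ≥ 5` (Serre) and at `p = 3` (Lemma 20); analytic rank (GZK) -/

/-- `p ≥ 5`: `ρ̄_{E,p}` onto gives every `ρ̄_{E,p^n}` onto (Serre; tree theorem), so the minimal-pair
main conjecture reads off `Rank1Residual.Surj W p`. [cite: Wuthrich2014, Cor. 19 proof (p. 399)] -/
theorem mazurMainConjectureAt_of_unitCoeffAt_mordellWeilRank_of_five_le
    (hKato : kato_charIdeal_dvd_multiplicative_of_surjective)
    (hp : 5 ≤ p) (hmult : W.HasMultiplicativeReductionAtPrime p)
    (hsurj : W.HasSurjectiveModNGaloisRep p) (hcert : UnitCoeffAt W p W.mordellWeilRank) :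
    X2.MazurMainConjectureAt W p :=
  mazurMainConjectureAt_of_unitCoeffAt_mordellWeilRank W p hKato (by omega) hmult
    (kato_charIdeal_dvd_multiplicative_of_surjective.surjective_pow_of_five_le W p hp hsurj) hcert

/-- `p = 3`: at a multiplicative `3`, `ρ̄_{E,3}` onto gives `ρ_{E,3^∞}` onto by Wuthrich's Lemma 20
(named fact `lemma20_surjective_threeAdic_of_semistable`, hypothesis `h20`; its level hypothesis
`3² ∤ N` is local and holds), so the minimal-pair main conjecture holds at `(E, 3)` exactly as for
`p ≥ 5` — census rev. 2 correction of §4.4 (3). [cite: Wuthrich2014, Lemma 20 (p. 399)] -/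
theorem mazurMainConjectureAt_three_of_unitCoeffAt_mordellWeilRank
    (hKato : kato_charIdeal_dvd_multiplicative_of_surjective)
    (h20 : lemma20_surjective_threeAdic_of_semistable)
    (W : WeierstrassCurve ℚ) [W.IsElliptic] [W.IsGloballyMinimal] [Fact (3 : ℕ).Prime]
    (hmult : W.HasMultiplicativeReductionAtPrime 3) (hsurj : W.HasSurjectiveModNGaloisRep 3)
    (hcert : UnitCoeffAt W 3 W.mordellWeilRank) : X2.MazurMainConjectureAt W 3 :=
  mazurMainConjectureAt_of_unitCoeffAt_mordellWeilRank W 3 hKato (by norm_num) hmult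
    (h20 W (Or.inr hmult) hsurj) hcert

/-- **Analytic-rank version** (the census indexes pairs by `r_an ≤ 1`): with Gross–Zagier–Kolyvagin
(`hGZK`, bsd.S17: `rank E(ℚ) = r_an` for `r_an ≤ 1`) the certificate at index `r_an + e` is the one
at `rank + e`. [cite: Miller2011LMS, Def. 1.1 and §1] [cite: SteinWuthrich2013, §11 remark (p. 29)] -/
theorem mazurMainConjectureAt_of_unitCoeffAt_analyticRank
    (hKato : kato_charIdeal_dvd_multiplicative_of_surjective)
    (hGZK : rank_eq_analyticRank_of_analyticRank_le_one)
    (hp2 : p ≠ 2) (hmult : W.HasMultiplicativeReductionAtPrime p)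
    (hsurj' : ∀ n : ℕ, W.HasSurjectiveModNGaloisRep (p ^ n : ℕ))
    (hr : W.analyticRank ≤ 1) (hcert : UnitCoeffAt W p W.analyticRank) :
    X2.MazurMainConjectureAt W p := by
  have hrk : W.mordellWeilRank = W.analyticRank := (hGZK W hr).1
  exact mazurMainConjectureAt_of_unitCoeffAt_mordellWeilRank W p hKato hp2 hmult hsurj' (hrk ▸ hcert)

/-- Analytic-rank version of the `ord_{T=0} f_E` package (for the rank-`1` rows of the census:
`UnitCoeffAt W p 1`, i.e. `[T^{1+e}](ϖ·L_p)` a unit, gives `ord_{T=0} f_E = 1` at every generator).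
[cite: Miller2011LMS, Def. 1.1 and §1] [cite: SteinWuthrich2013, §11 remark (p. 29)] -/
theorem invariantsAt_order_eq_of_unitCoeffAt_analyticRank
    (hKato : kato_charIdeal_dvd_multiplicative_of_surjective)
    (hGZK : rank_eq_analyticRank_of_analyticRank_le_one)
    (hp2 : p ≠ 2) (hmult : W.HasMultiplicativeReductionAtPrime p)
    (hsurj' : ∀ n : ℕ, W.HasSurjectiveModNGaloisRep (p ^ n : ℕ))
    (hr : W.analyticRank ≤ 1) (hcert : UnitCoeffAt W p W.analyticRank) :
    InvariantsAt W p fun g fE =>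
      Ideal.span ({g} : Set (IwasawaAlgebra p)) = Ideal.span {fE} ∧
        fE.order = W.analyticRank ∧ IsUnit (PowerSeries.coeff W.analyticRank fE) := by
  have hrk : W.mordellWeilRank = W.analyticRank := (hGZK W hr).1
  have h := invariantsAt_of_unitCoeffAt_mordellWeilRank W p hKato hp2 hmult hsurj' (hrk ▸ hcert)
  rw [hrk] at h
  exact h.mono fun _ _ h' => ⟨h'.1, h'.2.2.2.2.2.1, h'.2.2.2.2.2.2⟩

end Multiplicative


end Summit.BirchSwinnertonDyer.Rank1Residual.Iwasawa

end
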